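import Literature.Probability.RandomPlanarGeometry.LSW2004UST
import Literature.Probability.RandomPlanarGeometry.USTPeanoPathGeometry
import Literature.Probability.RandomPlanarGeometry.SlitLoewnerNested
import Literature.Probability.RandomPlanarGeometry.ChordalCapacityDivergence
import Literature.Probability.RandomPlanarGeometry.LoewnerSimpleIncrement
import HarnessLib

/-!
# [LSW04] Thm. 4.4 set-up: the capacity parametrisation of the UST Peano curve exists

Discharge of the named fact `USTPeano.exists_capacityImage` of `LSW2004UST.lean`
(G. F. Lawler, O. Schramm, W. Werner, Ann. Probab. **32** (2004), §2.1 pp. 946–947 and Thm. 4.4,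
p. 976: "let `γ̂ := φ ∘ γ`, parameterized according to capacity from `∞`, and let `W(t)` denote
the Loewner driving process for `γ̂`"): for every `D = D(α, β, a, b) ∈ 𝔇*` with `0 ∈ D`, every
normalised map `φ` and every Peano path `γ` there are `γ̂ ∈ C([0,∞), ℂ)`, `W ∈ C([0,∞), ℝ)` with
`IsCapacityImage D φ γ γ̂ W`.

Proof (G. F. Lawler, *Conformally Invariant Processes in the Plane* (2005), §4.1, Prop. 4.4 and
Remark 4.5, for the unbounded simple curve `η = φ⁻¹ ∘ γ` from `0` to `∞` in `ℍ`):

1. `exists_capacityCurve` — `η` is a simple curve in `ℍ ∪ {0}` on `[0, ℓ + 1)`, `η(0⁺) = 0`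
   (`φ⁻¹ → 0` at `a`), `im η(s) → ∞` as `s ↑ ℓ + 1` (the path enters `b` along a lattice edge
   transversal to the straight boundary; `PeanoPath.exists_halfDisc_at_b` and the Schwarz
   reflection estimate `MarkedDomain.IsChordalUniformizing.tendsto_im_symm_atTop`);
2. `exists_capFn` — `b(s) = hcap η(0, s]` from the tree's slit theory applied to the compact
   pieces `u ↦ η(su) + 1` (`IsPlusSlit`, translated to start at `1 > 0`): continuous, strictly
   increasing, `b(0) = 0` (Remark 4.5), and `b(s) ≥ (im η(s))²/2 → ∞`
   (`IsPlusSlit.im_sq_le_two_mul_cap`) — Lawler's hypothesis "`b(t) → ∞`" of Prop. 4.4;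
3. `exists_capacityInverse` — the inverse `σ = (b/2)⁻¹ : [0, ∞) → [0, ℓ + 1)`, continuous
   (an order isomorphism of intervals);
4. `exists_driving` — ONE driving function `W_t = U^{(s)}_t - 1` read off from any piece
   `s` with `b(s)/2 > t` (nested pieces have the same driving function,
   `IsPlusSlit.driving_initial`), continuous with `W_0 = 0`, whose hulls are
   `K_t = η(0, σ(t)]` (`Loewner.hull_eq_hull_of_eqOn`, `Loewner.hull_add_const`,
   `IsPlusSlit.hull_driving_of_le`);
5. `exists_capacity_parametrisation`, `USTPeano.exists_capacityImage_holds` — `γ̂ = η ∘ σ` is a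
   simple curve generating the chain (`Loewner.isGeneratedByCurve_of_simple`), and
   `θ = b/2` is the time change of `IsCapacityImage`.

## References

* G. F. Lawler, O. Schramm, W. Werner (2004), §2.1, §4.2, Thm. 4.4 [LawlerSchrammWerner2004].
* G. F. Lawler (2005), §4.1 Prop. 4.4, Remark 4.5 [Lawler2005].
-/

noncomputable section

open Set Function Filter MeasureTheory Complex Metric
open _root_.Topology
open UpperHalfPlane (upperHalfPlaneSet)
open scoped NNReal ENNReal

namespace Literature.Probability.RandomPlanarGeometry

namespace USTPeano

/-! ### 1. The curve `η = φ⁻¹ ∘ γ` -/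

/-- **The curve `η = φ⁻¹ ∘ γ` on `[0, ℓ + 1)`** for a Peano path `γ` of `D ∋ 0` and a
normalised map (`φ⁻¹ =` LSW's `φ : D → ℍ`): `η(0) = 0`, `η(s) = φ⁻¹(γ(s)) ∈ ℍ` for
`0 < s < ℓ + 1`, continuous on `[0, ℓ + 1)` (`φ⁻¹ → 0` at `a`), injective (the path is simple and
inside `D`), and `im η(s) → +∞` as `s ↑ ℓ + 1` (the last edge enters `b` transversally to the
straight boundary; Schwarz reflection). [cite: LawlerSchrammWerner2004, Thm. 4.4] -/
theorem exists_capacityCurve (Δ : Domain) (φ : ConformalEquiv upperHalfPlaneSet Δ.carrier)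
    (hφ : Δ.IsLSWMap φ) (γ : PeanoPath Δ) :
    ∃ η : ℝ → ℂ, η 0 = 0 ∧ (∀ s ∈ Ioo (0 : ℝ) γ.tlen, η s = φ.symm (γ.curve s)) ∧
      (∀ s ∈ Ioo (0 : ℝ) γ.tlen, 0 < (η s).im) ∧ ContinuousOn η (Ico 0 γ.tlen) ∧
      InjOn η (Ico 0 γ.tlen) ∧ Tendsto (fun s ↦ (η s).im) (𝓝[<] (γ.tlen : ℝ)) atTop := by
  set T : ℝ := (γ.tlen : ℝ) with hT
  have hT0 : 0 < T := by rw [hT]; exact_mod_cast γ.tlen_pos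
  set η : ℝ → ℂ := fun s ↦ if s ≤ 0 then 0 else φ.symm (γ.curve s) with hη
  have hη0 : η 0 = 0 := by simp [hη]
  have hηeq : ∀ s ∈ Ioo (0 : ℝ) T, η s = φ.symm (γ.curve s) := fun s hs ↦ by
    simp [hη, not_le.2 hs.1]
  have hmem : ∀ s ∈ Ioo (0 : ℝ) T, γ.curve s ∈ Δ.carrier := fun s hs ↦ γ.curve_mem_carrier hs
  have hpos : ∀ s ∈ Ioo (0 : ℝ) T, 0 < (η s).im := fun s hs ↦ by
    rw [hηeq s hs]; exact φ.symm_mapsTo (hmem s hs)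
  have hchord : Δ.toDobrushinDomain.IsChordalUniformizing φ := hφ.1
  refine ⟨η, hη0, hηeq, hpos, ?_, ?_, ?_⟩
  · -- continuity on `[0, T)`
    intro s hs
    rcases hs.1.eq_or_lt with h0 | h0
    · -- at `0`: `φ⁻¹(γ(s)) → 0`
      rw [← h0]
      have hlim := hchord.tendsto_symm_nhds_zero
      rw [Δ.toDobrushinDomain_pt_zero] at hlim
      have hcurve : Tendsto γ.curve (𝓝[Ioo (0 : ℝ) T] 0) (𝓝[Δ.carrier] (peanoPt Δ.a)) := by
        refine tendsto_nhdsWithin_of_tendsto_nhds_of_eventually_within _ ?_ ?_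
        · have := (γ.continuous_curve.tendsto 0).mono_left (nhdsWithin_le_nhds (s := Ioo (0 : ℝ) T))
          rwa [γ.curve_zero] at this
        · filter_upwards [self_mem_nhdsWithin] with s hs using hmem s hs
      have h1 : Tendsto η (𝓝[Ioo (0 : ℝ) T] 0) (𝓝 0) := by
        refine (hlim.comp hcurve).congr' ?_
        filter_upwards [self_mem_nhdsWithin] with s hs using (hηeq s hs).symm
      -- `𝓝[Ico 0 T] 0 ≤ 𝓝[Ioo 0 T] 0 ⊔ pure 0`
      rw [ContinuousWithinAt, hη0]
      have hsplit : Ico (0 : ℝ) T = insert 0 (Ioo (0 : ℝ) T) := by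
        ext x; simp only [mem_Ico, mem_insert_iff, mem_Ioo]
        constructor
        · rintro ⟨h1, h2⟩
          rcases h1.eq_or_lt with h | h
          · exact Or.inl h.symm
          · exact Or.inr ⟨h, h2⟩
        · rintro (rfl | ⟨h1, h2⟩)
          · exact ⟨le_rfl, hT0⟩
          · exact ⟨h1.le, h2⟩
      rw [hsplit, nhdsWithin_insert, tendsto_sup]
      exact ⟨by rw [← hη0]; exact tendsto_pure_nhds η 0, h1⟩
    · -- at `s > 0`: locally `φ⁻¹ ∘ γ`
      have hsD : γ.curve s ∈ Δ.carrier := hmem s ⟨h0, hs.2⟩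
      have h1 : ContinuousAt (fun s ↦ φ.symm (γ.curve s)) s :=
        (φ.symm.continuousOn.continuousAt (Δ.isOpen_carrier.mem_nhds hsD)).comp
          γ.continuous_curve.continuousAt
      have h2 : η =ᶠ[𝓝 s] fun s ↦ φ.symm (γ.curve s) := by
        filter_upwards [Ioi_mem_nhds h0] with x hx
        simp [hη, not_le.2 (show (0 : ℝ) < x from hx)]
      exact (h1.congr h2.symm).continuousWithinAt
  · -- injectivity on `[0, T)`
    intro s hs s' hs' heq
    rcases hs.1.eq_or_lt with h0 | h0 <;> rcases hs'.1.eq_or_lt with h0' | h0'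
    · rw [← h0, ← h0']
    · exfalso
      have := hpos s' ⟨h0', hs'.2⟩
      rw [← heq, ← h0, hη0, zero_im] at this
      exact lt_irrefl _ this
    · exfalso
      have := hpos s ⟨h0, hs.2⟩
      rw [heq, ← h0', hη0, zero_im] at this
      exact lt_irrefl _ this
    · rw [hηeq s ⟨h0, hs.2⟩, hηeq s' ⟨h0', hs'.2⟩] at heq
      have hc := φ.symm.injOn (hmem s ⟨h0, hs.2⟩) (hmem s' ⟨h0', hs'.2⟩) heq
      exact γ.injOn_curve ⟨hs.1, hs.2.le⟩ ⟨hs'.1, hs'.2.le⟩ hc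
  · -- `im η → ∞` at `T`
    obtain ⟨ρ, d, r, hρ, hr, hd, hin, hfr, hne, hlast⟩ := γ.exists_halfDisc_at_b
    have key := hchord.tendsto_im_symm_atTop (ρ := ρ) hρ hr (d := d)
    rw [Δ.toDobrushinDomain_pt_one, Δ.toDobrushinDomain_pt_zero] at key
    have key' := key hin hfr hne hd
    have hsub : Tendsto (fun s : ℝ ↦ T - s) (𝓝[<] T) (𝓝[>] 0) := by
      refine tendsto_nhdsWithin_of_tendsto_nhds_of_eventually_within _ ?_ ?_
      · have : Continuous fun s : ℝ ↦ T - s := by fun_prop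
        have h := this.tendsto T
        rw [sub_self] at h
        exact h.mono_left nhdsWithin_le_nhds
      · filter_upwards [self_mem_nhdsWithin] with s hs
        exact sub_pos.2 (show s < T from hs)
    refine ((key'.comp hsub).congr' ?_)
    have hwin : Ioo (max 0 (T - 1)) T ∈ 𝓝[<] T := Ioo_mem_nhdsLT (max_lt hT0 (by linarith))
    filter_upwards [hwin] with s hs
    have hs0 : 0 < s := (le_max_left _ _).trans_lt hs.1
    have hs1 : T - 1 < s := (le_max_right _ _).trans_lt hs.1
    simp only [Function.comp_apply]
    rw [hηeq s ⟨hs0, hs.2⟩, hlast s ⟨hs1.le, hs.2.le⟩]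
    rfl

/-! ### 2. The pieces `u ↦ η(su) + 1` and the capacity `b(s)` -/

section Abstract

variable {η : ℝ → ℂ} {T : ℝ}

/-- **The compact pieces are slits**: for `0 < s < T`, `u ↦ η(su) + 1` is a slit from the
positive real point `1` (`IsPlusSlit`; the translation by `1` only serves the normalisation of
the tree's restriction maps). [cite: Lawler2005, §4.1] -/
theorem isPlusSlit_rescale (h0 : η 0 = 0) (hc : ContinuousOn η (Ico 0 T)) (hi : InjOn η (Ico 0 T))
    (hp : ∀ s ∈ Ioo 0 T, 0 < (η s).im) {s : ℝ} (hs : s ∈ Ioo 0 T) :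
    IsPlusSlit (fun u ↦ η (s * u) + 1) where
  continuousOn := by
    refine (hc.comp (continuousOn_const.mul continuousOn_id) fun u hu ↦ ?_).add continuousOn_const
    exact ⟨mul_nonneg hs.1.le hu.1, lt_of_le_of_lt (mul_le_of_le_one_right hs.1.le hu.2) hs.2⟩
  injOn u hu u' hu' heq := by
    have h1 : η (s * u) = η (s * u') := by simpa using heq
    have hm : ∀ x ∈ Icc (0 : ℝ) 1, s * x ∈ Ico 0 T := fun x hx ↦
      ⟨mul_nonneg hs.1.le hx.1, lt_of_le_of_lt (mul_le_of_le_one_right hs.1.le hx.2) hs.2⟩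
    exact mul_left_cancel₀ hs.1.ne' (hi (hm u hu) (hm u' hu') h1)
  im_zero := by simp [h0]
  re_pos := by simp [h0]
  im_pos u hu := by
    have : s * u ∈ Ioo 0 T := ⟨mul_pos hs.1 hu.1, lt_of_le_of_lt (mul_le_of_le_one_right hs.1.le hu.2) hs.2⟩
    simpa using hp _ this

/-- Transport of the capacity along an equality of curves. [folklore] -/
theorem _root_.Literature.Probability.RandomPlanarGeometry.IsPlusSlit.cap_congr {γ γ' : ℝ → ℂ}
    (h : IsPlusSlit γ) (h' : IsPlusSlit γ') (e : γ = γ') (u : ℝ) : h.cap u = h'.cap u := by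
  subst e; rfl

/-- Transport of the driving function along an equality of curves. [folklore] -/
theorem _root_.Literature.Probability.RandomPlanarGeometry.IsPlusSlit.driving_congr {γ γ' : ℝ → ℂ}
    (h : IsPlusSlit γ) (h' : IsPlusSlit γ') (e : γ = γ') (t : ℝ≥0) : h.driving t = h'.driving t := by
  subst e; rfl

/-- Transport of the time change along an equality of curves. [folklore] -/
theorem _root_.Literature.Probability.RandomPlanarGeometry.IsPlusSlit.timeChange_congr {γ γ' : ℝ → ℂ}
    (h : IsPlusSlit γ) (h' : IsPlusSlit γ') (e : γ = γ') (t : ℝ) : h.timeChange t = h'.timeChange t := by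
  subst e; rfl

/-- **The capacities of the pieces are compatible**: the piece `su`, `u ∈ (0, 1]`, is the initial
piece of the piece `s`, so `hcap η(0, su] = b_s(u)` (`IsPlusSlit.cap_initial`). [cite: Lawler2005, Remark 4.5] -/
theorem cap_rescale_mul {s u : ℝ} (hu : u ∈ Ioc (0 : ℝ) 1)
    (h : IsPlusSlit (fun u ↦ η (s * u) + 1)) (h' : IsPlusSlit (fun u' ↦ η (s * u * u') + 1)) :
    h'.cap 1 = h.cap u := by
  have hin := h.initial hu.1 hu.2
  have e : (fun u' ↦ η (s * u * u') + 1) = (fun u' ↦ (fun u ↦ η (s * u) + 1) (u * u')) := by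
    funext u'; simp [mul_assoc]
  rw [h'.cap_congr hin e 1, h.cap_initial hu.1 hu.2 hin ⟨zero_le_one, le_rfl⟩, mul_one]

/-- **The driving functions of the pieces are compatible**: for `s ≤ s'` the piece `s` is the
initial piece `v = s/s'` of the piece `s'`, so their driving functions agree on `[0, b(s)/2]`
(`IsPlusSlit.driving_initial`). [cite: Lawler2005, Prop. 4.4] -/
theorem driving_rescale_eq {s s' : ℝ} (hs : 0 < s) (hss' : s ≤ s')
    (h : IsPlusSlit (fun u ↦ η (s * u) + 1)) (h' : IsPlusSlit (fun u ↦ η (s' * u) + 1))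
    (t : ℝ≥0) (ht : (t : ℝ) ≤ h.capTime) : h.driving t = h'.driving t := by
  have hs' : 0 < s' := hs.trans_le hss'
  have hv0 : 0 < s / s' := div_pos hs hs'
  have hv1 : s / s' ≤ 1 := (div_le_one hs').2 hss'
  have hin := h'.initial hv0 hv1
  have e : (fun u ↦ η (s * u) + 1) = (fun u ↦ (fun u ↦ η (s' * u) + 1) (s / s' * u)) := by
    funext u
    simp only
    rw [← mul_assoc, mul_div_cancel₀ _ hs'.ne']
  rw [h.driving_congr hin e t]
  refine h'.driving_initial hv0 hv1 hin t ?_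
  rwa [← IsPlusSlit.capTime.congr_simp e h]

/-- **The capacity function `b(s) = hcap η(0, s]`** of an unbounded simple curve `η` from `0`
(continuous and injective on `[0, T)`, `η(0, T) ⊂ ℍ`, `im η → ∞` at `T`): there is `b` with
`b(0) = 0`, `b(su) = b_s(u)` for the pieces, continuous and strictly increasing on `[0, T)`,
nonnegative, and `b(s) → ∞` as `s ↑ T` (by `b(s) ≥ (im η(s))²/2`, `IsPlusSlit.im_sq_le_two_mul_cap`).
Lawler (2005), Remark 4.5 ("`b` is strictly increasing … continuous") and the hypothesis
"`b(t) → ∞`" of Prop. 4.4. [cite: Lawler2005, Remark 4.5] -/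
theorem exists_capFn (hT : 0 < T) (h0 : η 0 = 0) (hc : ContinuousOn η (Ico 0 T)) (hi : InjOn η (Ico 0 T))
    (hp : ∀ s ∈ Ioo 0 T, 0 < (η s).im) (hinf : Tendsto (fun s ↦ (η s).im) (𝓝[<] T) atTop) :
    ∃ b : ℝ → ℝ, b 0 = 0 ∧
      (∀ s (hs : s ∈ Ioo 0 T) (h : IsPlusSlit (fun u ↦ η (s * u) + 1)), ∀ u ∈ Icc (0 : ℝ) 1, b (s * u) = h.cap u) ∧
      ContinuousOn b (Ico 0 T) ∧ StrictMonoOn b (Ico 0 T) ∧ (∀ s ∈ Ico 0 T, 0 ≤ b s) ∧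
      Tendsto b (𝓝[<] T) atTop := by
  have slit : ∀ {s : ℝ}, s ∈ Ioo 0 T → IsPlusSlit (fun u ↦ η (s * u) + 1) :=
    fun hs ↦ isPlusSlit_rescale h0 hc hi hp hs
  set b : ℝ → ℝ := fun s ↦ if hs : s ∈ Ioo 0 T then (slit hs).cap 1 else 0 with hb
  have hb0 : b 0 = 0 := by simp [hb]
  have hbs : ∀ {s : ℝ} (hs : s ∈ Ioo 0 T), b s = (slit hs).cap 1 := fun hs ↦ by
    simp only [hb]
    exact dif_pos hs
  -- the key relation with the pieces
  have hkey : ∀ s (hs : s ∈ Ioo 0 T) (h : IsPlusSlit (fun u ↦ η (s * u) + 1)),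
      ∀ u ∈ Icc (0 : ℝ) 1, b (s * u) = h.cap u := by
    intro s hs h u hu
    rcases hu.1.eq_or_lt with hu0 | hu0
    · rw [← hu0, mul_zero, hb0, h.cap_zero]
    · have hsu : s * u ∈ Ioo 0 T := ⟨mul_pos hs.1 hu0, lt_of_le_of_lt (mul_le_of_le_one_right hs.1.le hu.2) hs.2⟩
      rw [hbs hsu]
      exact cap_rescale_mul ⟨hu0, hu.2⟩ h (slit hsu)
  -- `b` on `[0, s₁]` is `b_{s₁}(·/s₁)`
  have hloc : ∀ {s₁ : ℝ} (hs₁ : s₁ ∈ Ioo 0 T), ∀ s ∈ Icc 0 s₁, b s = (slit hs₁).cap (s / s₁) := by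
    intro s₁ hs₁ s hs
    have := hkey s₁ hs₁ (slit hs₁) (s / s₁) ⟨div_nonneg hs.1 hs₁.1.le, (div_le_one hs₁.1).2 hs.2⟩
    rwa [mul_div_cancel₀ _ hs₁.1.ne'] at this
  have hcontIcc : ∀ {s₁ : ℝ} (hs₁ : s₁ ∈ Ioo 0 T), ContinuousOn b (Icc 0 s₁) := by
    intro s₁ hs₁
    have h1 : ContinuousOn (fun s ↦ (slit hs₁).cap (s / s₁)) (Icc 0 s₁) :=
      (slit hs₁).continuousOn_cap.comp (continuousOn_id.div_const _) fun s hs ↦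
        ⟨div_nonneg hs.1 hs₁.1.le, (div_le_one hs₁.1).2 hs.2⟩
    exact h1.congr fun s hs ↦ hloc hs₁ s hs
  refine ⟨b, hb0, hkey, ?_, ?_, ?_, ?_⟩
  · -- continuity on `[0, T)`
    intro s₀ hs₀
    obtain ⟨s₁, hs₀₁, hs₁T⟩ := exists_between hs₀.2
    have hs₁ : s₁ ∈ Ioo 0 T := ⟨hs₀.1.trans_lt hs₀₁, hs₁T⟩
    have h1 : ContinuousWithinAt b (Icc 0 s₁) s₀ := hcontIcc hs₁ s₀ ⟨hs₀.1, hs₀₁.le⟩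
    refine (h1.mono_of_mem_nhdsWithin ?_)
    have : Ico (0 : ℝ) T ∩ Iio s₁ ⊆ Icc 0 s₁ := fun x hx ↦ ⟨hx.1.1, le_of_lt hx.2⟩
    exact mem_of_superset (inter_mem_nhdsWithin _ (Iio_mem_nhds hs₀₁)) this
  · -- strict monotonicity
    intro s hs s' hs' hss'
    have hs'0 : 0 < s' := hs.1.trans_lt hss'
    have hs'I : s' ∈ Ioo 0 T := ⟨hs'0, hs'.2⟩
    rw [hloc hs'I s ⟨hs.1, hss'.le⟩, hloc hs'I s' ⟨hs'0.le, le_rfl⟩, div_self hs'0.ne']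
    exact (slit hs'I).strictMonoOn_cap ⟨div_nonneg hs.1 hs'0.le, (div_le_one hs'0).2 hss'.le⟩
      ⟨zero_le_one, le_rfl⟩ ((div_lt_one hs'0).2 hss')
  · -- nonnegativity
    intro s hs
    rcases hs.1.eq_or_lt with h | h
    · rw [← h, hb0]
    · rw [hbs ⟨h, hs.2⟩]
      exact (slit ⟨h, hs.2⟩).cap_nonneg zero_le_one le_rfl
  · -- divergence: `b(s) ≥ (im η s)²/2 → ∞`
    have hsq : Tendsto (fun s ↦ (η s).im ^ 2 / 2) (𝓝[<] T) atTop := by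
      have h2 : Tendsto (fun s ↦ (η s).im ^ 2) (𝓝[<] T) atTop :=
        (tendsto_pow_atTop two_ne_zero).comp hinf
      exact h2.atTop_div_const (by norm_num)
    refine tendsto_atTop_mono' _ ?_ hsq
    filter_upwards [Ioo_mem_nhdsLT hT] with s hs
    rw [hbs hs]
    have := (slit hs).im_sq_le_two_mul_cap one_pos le_rfl
    simp only [mul_one, add_im, one_im, add_zero] at this
    linarith

/-! ### 3. The inverse time change `σ = (b/2)⁻¹` -/

/-- **The inverse of the capacity clock.** For `b` continuous and strictly increasing on
`[0, T)` (`T > 0`) with `b(0) = 0` and `b → ∞` at `T`, the inverse `σ` of `s ↦ b(s)/2` is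
defined on `[0, ∞)` with values in `[0, T)`, `b(σ(y)) = 2y`, `σ(0) = 0`, `σ(b(s)/2) = s`,
strictly increasing and CONTINUOUS on `[0, ∞)` (an order isomorphism between the intervals
`[0, T)` and `[0, ∞)`). Lawler (2005), Remark 4.5: "let `γ̃(t) = γ(b⁻¹(2t))`".
[cite: Lawler2005, Remark 4.5] -/
theorem exists_capacityInverse (hT : 0 < T) {b : ℝ → ℝ} (hb0 : b 0 = 0) (hbc : ContinuousOn b (Ico 0 T))
    (hbm : StrictMonoOn b (Ico 0 T)) (hbinf : Tendsto b (𝓝[<] T) atTop) :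
    ∃ σ : ℝ → ℝ, (∀ y, 0 ≤ y → σ y ∈ Ico 0 T ∧ b (σ y) = 2 * y) ∧ σ 0 = 0 ∧
      (∀ s ∈ Ico 0 T, σ (b s / 2) = s) ∧ StrictMonoOn σ (Ici 0) ∧ ContinuousOn σ (Ici 0) := by
  set θ : ℝ → ℝ := fun s ↦ b s / 2 with hθ
  have hθm : StrictMonoOn θ (Ico 0 T) := fun s hs s' hs' h ↦ by
    simp only [hθ]; linarith [hbm hs hs' h]
  -- the image of `[0, T)` is `[0, ∞)`
  have himage : θ '' Ico 0 T = Ici 0 := by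
    apply Subset.antisymm
    · rintro _ ⟨s, hs, rfl⟩
      have : b 0 ≤ b s := hbm.monotoneOn ⟨le_rfl, hT⟩ hs hs.1
      show 0 ≤ b s / 2
      rw [hb0] at this; linarith
    · intro y hy
      have hy' : (0 : ℝ) ≤ y := hy
      -- a point `s₁ < T` with `b s₁ ≥ 2 y`
      have hev : ∀ᶠ s in 𝓝[<] T, 2 * y ≤ b s ∧ s ∈ Ioo 0 T := by
        filter_upwards [hbinf.eventually (eventually_ge_atTop (2 * y)), Ioo_mem_nhdsLT hT] with s h1 h2
        exact ⟨h1, h2⟩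
      obtain ⟨s₁, hbs₁, hs₁⟩ := hev.exists
      have hcont : ContinuousOn b (Icc 0 s₁) := hbc.mono fun x hx ↦ ⟨hx.1, hx.2.trans_lt hs₁.2⟩
      have hIVT := intermediate_value_Icc hs₁.1.le hcont
      rw [hb0] at hIVT
      obtain ⟨s, hs, hbs⟩ := hIVT ⟨by linarith, hbs₁⟩
      refine ⟨s, ⟨hs.1, hs.2.trans_lt hs₁.2⟩, ?_⟩
      show b s / 2 = y
      rw [hbs]; ring
  -- the order isomorphism and its continuous inverse
  set e : Ico (0 : ℝ) T ≃o Ici (0 : ℝ) := (hθm.orderIso θ (Ico 0 T)).trans (OrderIso.setCongr _ _ himage)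
    with he
  have heval : ∀ x : Ico (0 : ℝ) T, ((e x : Ici (0 : ℝ)) : ℝ) = θ x := fun x ↦ rfl
  have hsymm_cont : Continuous e.symm := e.symm.continuous
  set σ : ℝ → ℝ := fun y ↦ if hy : 0 ≤ y then ((e.symm ⟨y, hy⟩ : Ico (0 : ℝ) T) : ℝ) else 0 with hσ
  have hσval : ∀ {y : ℝ} (hy : 0 ≤ y), σ y = ((e.symm ⟨y, hy⟩ : Ico (0 : ℝ) T) : ℝ) := fun hy ↦ by
    simp [hσ, hy]
  have hσmem : ∀ {y : ℝ} (hy : 0 ≤ y), σ y ∈ Ico 0 T := fun hy ↦ by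
    rw [hσval hy]; exact Subtype.mem _
  have hθσ : ∀ {y : ℝ} (hy : 0 ≤ y), θ (σ y) = y := by
    intro y hy
    have h1 := e.apply_symm_apply ⟨y, hy⟩
    have h2 := congrArg (fun z : Ici (0 : ℝ) ↦ (z : ℝ)) h1
    simp only at h2
    rw [heval] at h2
    rw [hσval hy]
    exact h2
  refine ⟨σ, fun y hy ↦ ⟨hσmem hy, ?_⟩, ?_, ?_, ?_, ?_⟩
  · have := hθσ hy
    simp only [hθ] at this
    linarith
  · -- `σ 0 = 0`
    have h1 : θ (σ 0) = θ 0 := by rw [hθσ le_rfl]; simp [hθ, hb0]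
    exact hθm.injOn (hσmem le_rfl) ⟨le_rfl, hT⟩ h1
  · -- `σ (b s / 2) = s`
    intro s hs
    have hy : 0 ≤ b s / 2 := by
      have : b 0 ≤ b s := hbm.monotoneOn ⟨le_rfl, hT⟩ hs hs.1
      rw [hb0] at this; linarith
    exact hθm.injOn (hσmem hy) hs (hθσ hy)
  · -- strict monotonicity
    intro y hy y' hy' hyy'
    have hy0 : 0 ≤ y := hy
    have hy0' : 0 ≤ y' := hy'
    rw [← hθm.lt_iff_lt (hσmem hy0) (hσmem hy0'), hθσ hy0, hθσ hy0']
    exact hyy'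
  · -- continuity on `[0, ∞)`
    rw [continuousOn_iff_continuous_restrict]
    have : (Ici (0 : ℝ)).restrict σ = fun y : Ici (0 : ℝ) ↦ ((e.symm y : Ico (0 : ℝ) T) : ℝ) := by
      funext y
      simp only [restrict_apply]
      rw [hσval y.2]
    rw [this]
    exact continuous_subtype_val.comp hsymm_cont

/-! ### 4. One driving function for all pieces, and its hulls -/

/-- **The driving function of the unbounded curve and its hulls.** Given the capacity `b` and its
inverse clock `σ`, there is a continuous `W : [0, ∞) → ℝ` with `W_0 = 0` whose Loewner hulls are
`K_t = η(0, σ(t)]` for all `t > 0`: `W_t := U^{(s)}_t - 1` for any piece `s` with `b(s)/2 > t`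
(well defined by `driving_rescale_eq`); `K_t` only depends on `W|[0, t]`
(`Loewner.hull_eq_hull_of_eqOn`), translation by `-1` moves hulls (`Loewner.hull_add_const`), and
the hull of the piece at time `t` is its initial arc of capacity `2t`
(`IsPlusSlit.hull_driving_of_le`). Lawler (2005), Prop. 4.4. [cite: Lawler2005, Prop. 4.4] -/
theorem exists_driving (h0 : η 0 = 0) (hc : ContinuousOn η (Ico 0 T)) (hi : InjOn η (Ico 0 T))
    (hp : ∀ s ∈ Ioo 0 T, 0 < (η s).im) {b : ℝ → ℝ} (hb0 : b 0 = 0)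
    (hkey : ∀ s (hs : s ∈ Ioo 0 T) (h : IsPlusSlit (fun u ↦ η (s * u) + 1)), ∀ u ∈ Icc (0 : ℝ) 1, b (s * u) = h.cap u)
    (hbm : StrictMonoOn b (Ico 0 T)) {σ : ℝ → ℝ} (hσ : ∀ y, 0 ≤ y → σ y ∈ Ico 0 T ∧ b (σ y) = 2 * y) :
    ∃ W : ℝ≥0 → ℝ, Continuous W ∧ W 0 = 0 ∧ ∀ t : ℝ≥0, 0 < t → Loewner.hull W t = η '' Ioc 0 (σ t) := by
  have slit : ∀ {s : ℝ}, s ∈ Ioo 0 T → IsPlusSlit (fun u ↦ η (s * u) + 1) :=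
    fun hs ↦ isPlusSlit_rescale h0 hc hi hp hs
  have hcapTime : ∀ {s : ℝ} (hs : s ∈ Ioo 0 T), (slit hs).capTime = b s / 2 := fun {s} hs ↦ by
    rw [IsPlusSlit.capTime, ← hkey s hs (slit hs) 1 ⟨zero_le_one, le_rfl⟩, mul_one]
  -- the piece used at time `t`: `s(t) = σ(t + 1)`, with `b(s(t))/2 = t + 1`
  have hsI : ∀ t : ℝ≥0, σ (t + 1) ∈ Ioo 0 T := by
    intro t
    obtain ⟨hmem, hb⟩ := hσ (t + 1) (by positivity)
    refine ⟨hmem.1.lt_of_ne fun h ↦ ?_, hmem.2⟩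
    rw [← h, hb0] at hb
    have : (0 : ℝ) ≤ t := t.2
    linarith
  set W : ℝ≥0 → ℝ := fun t ↦ (slit (hsI t)).driving t - 1 with hW
  -- consistency: any piece `s₁` with `t ≤ b(s₁)/2` computes `W t`
  have hWeq : ∀ {s₁ : ℝ} (hs₁ : s₁ ∈ Ioo 0 T) (t : ℝ≥0), (t : ℝ) ≤ b s₁ / 2 →
      W t = (slit hs₁).driving t - 1 := by
    intro s₁ hs₁ t ht
    simp only [hW]
    congr 1
    rcases le_total (σ (t + 1)) s₁ with hle | hle
    · refine driving_rescale_eq (hsI t).1 hle (slit (hsI t)) (slit hs₁) t ?_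
      rw [hcapTime (hsI t), (hσ (t + 1) (by positivity)).2]
      linarith
    · refine (driving_rescale_eq hs₁.1 hle (slit hs₁) (slit (hsI t)) t ?_).symm
      rwa [hcapTime hs₁]
  have hW0 : W 0 = 0 := by
    simp only [hW, (slit (hsI 0)).driving_zero, mul_zero, h0, zero_add, one_re, sub_self]
  have hWc : Continuous W := by
    rw [continuous_iff_continuousAt]
    intro t₀
    have hs₁ := hsI t₀
    have hb₁ : b (σ (t₀ + 1)) / 2 = t₀ + 1 := by
      rw [(hσ (t₀ + 1) (by positivity)).2]; ring
    have hev : W =ᶠ[𝓝 t₀] fun t ↦ (slit hs₁).driving t - 1 := by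
      have hopen : IsOpen {t : ℝ≥0 | (t : ℝ) < t₀ + 1} := isOpen_lt continuous_subtype_val continuous_const
      filter_upwards [hopen.mem_nhds (show (t₀ : ℝ) < t₀ + 1 by linarith)] with t ht
      exact hWeq hs₁ t (by rw [hb₁]; exact le_of_lt ht)
    exact (((slit hs₁).continuous_driving.sub continuous_const).continuousAt).congr hev.symm
  refine ⟨W, hWc, hW0, fun t ht ↦ ?_⟩
  -- the hull at time `t > 0`, through the piece `s₁ = σ(t + 1)`
  have hs₁ := hsI t
  set s₁ : ℝ := σ (t + 1) with hs₁def
  have hb₁ : b s₁ / 2 = t + 1 := by rw [hs₁def, (hσ (t + 1) (by positivity)).2]; ring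
  have htS : (t : ℝ) ≤ (slit hs₁).capTime := by rw [hcapTime hs₁, hb₁]; linarith
  have h1 : Loewner.hull W t = Loewner.hull (fun u ↦ (slit hs₁).driving u + (-1)) t := by
    refine Loewner.hull_eq_hull_of_eqOn (W' := fun u ↦ (slit hs₁).driving u + (-1)) hWc
      ((slit hs₁).continuous_driving.add continuous_const) fun u hu ↦ ?_
    rw [hWeq hs₁ u ((show (u : ℝ) ≤ t by exact_mod_cast hu).trans (by rw [hb₁]; linarith)), sub_eq_add_neg]
  rw [h1, Loewner.hull_add_const, (slit hs₁).hull_driving_of_le ht htS]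
  -- identify the arc: `s₁ σ₁(t) = σ(t)` since both have capacity `2t`
  set u₁ : ℝ := (slit hs₁).timeChange t with hu₁
  have ht0' : (0 : ℝ) ≤ t := t.2
  have hu₁mem : u₁ ∈ Icc (0 : ℝ) 1 := (slit hs₁).timeChange_mem ⟨ht0', htS⟩
  have hcapu₁ : (slit hs₁).cap u₁ = 2 * t := (slit hs₁).cap_timeChange ⟨ht0', htS⟩
  have hσt : s₁ * u₁ = σ t := by
    have hmem1 : s₁ * u₁ ∈ Ico 0 T :=
      ⟨mul_nonneg hs₁.1.le hu₁mem.1, lt_of_le_of_lt (mul_le_of_le_one_right hs₁.1.le hu₁mem.2) hs₁.2⟩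
    refine hbm.injOn hmem1 (hσ t ht0').1 ?_
    rw [hkey s₁ hs₁ (slit hs₁) u₁ hu₁mem, hcapu₁, (hσ t ht0').2]
  rw [← hσt, ← image_comp]
  ext z
  simp only [mem_image, Function.comp_apply, mem_Ioc]
  constructor
  · rintro ⟨u, ⟨hu0, huu₁⟩, rfl⟩
    refine ⟨s₁ * u, ⟨mul_pos hs₁.1 hu0, mul_le_mul_of_nonneg_left huu₁ hs₁.1.le⟩, ?_⟩
    push_cast; ring
  · rintro ⟨x, ⟨hx0, hxu⟩, rfl⟩
    refine ⟨x / s₁, ⟨div_pos hx0 hs₁.1, ?_⟩, ?_⟩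
    · rwa [div_le_iff₀ hs₁.1, mul_comm]
    · rw [mul_div_cancel₀ _ hs₁.1.ne']; push_cast; ring

/-! ### 5. The capacity parametrisation of an unbounded simple curve -/

/-- **Parametrisation by capacity of an unbounded simple curve from `0` in `ℍ`** (Lawler (2005),
Prop. 4.4 with Remark 4.5; [LSW04] §2.1: "one can reparametrize `η` in such a way that
`a(t) = 2t` … `η` is determined by `W`"). For `η` continuous and injective on `[0, T)` with
`η(0) = 0`, `η(0, T) ⊂ ℍ` and `im η → ∞` at `T`, there are a time change
`θ : [0, T) → [0, ∞)` (continuous, strictly increasing, `θ(0) = 0`, `θ → ∞`), the reparametrised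
curve `γ̂ = η ∘ θ⁻¹` (continuous, `γ̂(0) = 0`, `γ̂(θ(s)) = η(s)`) and a continuous driving function
`W` whose chordal Loewner chain is generated by `γ̂` (`Loewner.isGeneratedByCurve_of_simple`
with the hulls `η(0, σ(t)]` of `exists_driving`). [cite: Lawler2005, Prop. 4.4] -/
theorem exists_capacity_parametrisation (hT : 0 < T) (h0 : η 0 = 0) (hc : ContinuousOn η (Ico 0 T))
    (hi : InjOn η (Ico 0 T)) (hp : ∀ s ∈ Ioo 0 T, 0 < (η s).im)
    (hinf : Tendsto (fun s ↦ (η s).im) (𝓝[<] T) atTop) :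
    ∃ (θ : ℝ → ℝ≥0) (γhat : ℝ≥0 → ℂ) (W : ℝ≥0 → ℝ), ContinuousOn θ (Ico 0 T) ∧ StrictMonoOn θ (Ico 0 T) ∧
      θ 0 = 0 ∧ Tendsto θ (𝓝[<] T) atTop ∧ (∀ s ∈ Ioo 0 T, γhat (θ s) = η s) ∧ γhat 0 = 0 ∧
      Continuous γhat ∧ Continuous W ∧ Loewner.IsGeneratedByCurve W γhat := by
  obtain ⟨b, hb0, hkey, hbc, hbm, hbnn, hbinf⟩ := exists_capFn hT h0 hc hi hp hinf
  obtain ⟨σ, hσ, hσ0, hσb, hσm, hσc⟩ := exists_capacityInverse hT hb0 hbc hbm hbinf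
  obtain ⟨W, hWc, hW0, hhull⟩ := exists_driving h0 hc hi hp hb0 hkey hbm hσ
  -- the reparametrised curve
  set γhat : ℝ≥0 → ℂ := fun t ↦ η (σ t) with hγhat
  have hσcont : Continuous fun t : ℝ≥0 ↦ σ t := hσc.comp_continuous continuous_subtype_val fun t ↦ t.2
  have hγc : Continuous γhat := hc.comp_continuous hσcont fun t ↦ (hσ t t.2).1
  have hγ0 : γhat 0 = 0 := by simp [hγhat, hσ0, h0]
  have hσpos : ∀ t : ℝ≥0, 0 < t → 0 < σ t := fun t ht ↦ by
    have := hσm (Set.self_mem_Ici : (0 : ℝ) ∈ Ici 0) (show (t : ℝ) ∈ Ici 0 from t.2) (by exact_mod_cast ht)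
    rwa [hσ0] at this
  have hγpos : ∀ t : ℝ≥0, 0 < t → 0 < (γhat t).im := fun t ht ↦
    hp _ ⟨hσpos t ht, (hσ t t.2).1.2⟩
  have hγinj : Injective γhat := by
    intro t t' h
    have h1 := hi (hσ t t.2).1 (hσ t' t'.2).1 h
    have h2 := hσm.injOn (show (t : ℝ) ∈ Ici 0 from t.2) (show (t' : ℝ) ∈ Ici 0 from t'.2) h1
    exact_mod_cast h2
  -- the hulls are the arcs of `γhat`
  have hhull' : ∀ u : ℝ≥0, Loewner.hull W u = γhat '' Ioc 0 u := by
    intro u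
    rcases eq_or_lt_of_le (show (0 : ℝ≥0) ≤ u from bot_le) with hu | hu
    · rw [← hu, Loewner.hull_zero_holds hWc]
      simp
    · rw [hhull u hu]
      ext z
      simp only [mem_image, mem_Ioc, hγhat]
      constructor
      · rintro ⟨x, ⟨hx0, hxu⟩, rfl⟩
        -- `x = σ (b x / 2)` with `b x / 2 ∈ (0, u]`
        have hxT : x ∈ Ico 0 T := ⟨hx0.le, hxu.trans_lt (hσ u u.2).1.2⟩
        have hbx : 0 < b x := by
          have := hbm ⟨le_rfl, hT⟩ hxT hx0
          rwa [hb0] at this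
        refine ⟨⟨b x / 2, by positivity⟩, ⟨?_, ?_⟩, ?_⟩
        · change (0 : ℝ) < b x / 2
          positivity
        · change b x / 2 ≤ (u : ℝ)
          have h1 : b x ≤ b (σ u) := hbm.monotoneOn hxT (hσ u u.2).1 hxu
          rw [(hσ u u.2).2] at h1
          linarith
        · change η (σ (b x / 2)) = η x
          rw [hσb x hxT]
      · rintro ⟨t, ⟨ht0, htu⟩, rfl⟩
        refine ⟨σ t, ⟨hσpos t ht0, ?_⟩, rfl⟩
        exact hσm.monotoneOn (show (t : ℝ) ∈ Ici 0 from t.2) (show (u : ℝ) ∈ Ici 0 from u.2)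
          (by exact_mod_cast htu)
  have hgen : Loewner.IsGeneratedByCurve W γhat :=
    Loewner.isGeneratedByCurve_of_simple hγc hγinj (by rw [hγ0, hW0, ofReal_zero]) hγpos hhull'
  -- the time change `θ = b/2`
  set θ : ℝ → ℝ≥0 := fun s ↦ (b s / 2).toNNReal with hθ
  refine ⟨θ, γhat, W, ?_, ?_, ?_, ?_, ?_, hγ0, hγc, hWc, hgen⟩
  · exact continuous_real_toNNReal.comp_continuousOn (hbc.div_const 2)
  · intro s hs s' hs' hss'
    simp only [hθ]
    rw [Real.toNNReal_lt_toNNReal_iff (by linarith [hbnn s hs, hbm hs hs' hss'])]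
    linarith [hbm hs hs' hss']
  · simp [hθ, hb0]
  · exact tendsto_real_toNNReal_atTop.comp (hbinf.atTop_div_const (by norm_num))
  · intro s hs
    simp only [hγhat, hθ]
    have hnn : 0 ≤ b s / 2 := by linarith [hbnn s ⟨hs.1.le, hs.2⟩]
    rw [Real.coe_toNNReal _ hnn, hσb s ⟨hs.1.le, hs.2⟩]

end Abstract

/-! ### The discharge -/

/-- **[LSW04] §2.1 / Thm. 4.4 set-up, PROVED: the capacity parametrisation and the driving
function of `φ⁻¹ ∘ γ` exist** for every Peano path `γ` of every `D ∈ 𝔇*` with `0 ∈ D` and every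
normalised map `φ` (the named fact `USTPeano.exists_capacityImage`): `η = φ⁻¹ ∘ γ` is an
unbounded simple curve from `0` in `ℍ` with `im η → ∞` (`exists_capacityCurve`), and
`exists_capacity_parametrisation` (Lawler (2005), Prop. 4.4 / Remark 4.5 through the tree's slit
theorem) supplies `γ̂`, `W` and the time change. [cite: LawlerSchrammWerner2004, Thm. 4.4] -/
theorem exists_capacityImage_holds : exists_capacityImage := by
  intro Δ _ φ hφ γ
  obtain ⟨η, hη0, hηeq, hηpos, hηc, hηi, hηinf⟩ := exists_capacityCurve Δ φ hφ γ
  have hT : (0 : ℝ) < γ.tlen := by exact_mod_cast γ.tlen_pos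
  obtain ⟨θ, γhat, W, hθc, hθm, hθ0, hθinf, hθη, hγ0, hγc, hWc, hgen⟩ :=
    exists_capacity_parametrisation hT hη0 hηc hηi hηpos hηinf
  refine ⟨⟨γhat, hγc⟩, ⟨W, hWc⟩, ⟨θ, hθc, hθm, hθ0, hθinf, fun s hs ↦ ?_⟩, hγ0, hgen⟩
  change γhat (θ s) = φ.symm (γ.curve s)
  rw [hθη s hs, hηeq s hs]

end USTPeano

end Literature.Probability.RandomPlanarGeometry
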